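import Mathlib
import Summits.Ventures.PercRepro.TriangleCapBelowGen

/-!
# PercRepro — THE STABILITY TABLE BELOW THE DIAGONAL FOR EVERY DISTANCE `r ≤ a − 3` ON EVERY ROW `a ≤ 18`: on the
cell `(k, a, r)` with `4 ≤ a ≤ 18`, `r + 3 ≤ a`, `2a + r ≤ k`, every `K₄⁻`-free graph that is not `a`-bipartite is at
least `B2 = 2 (k − 2a − 1)(a − r)` below the closed form — the window convexity dissolves the corner
(p3, gen 47; part 200d)

Part 196c (gen 44) proved this for `r ≤ 2`; the only place where `r ≤ 2` entered was THE CORNER `k = 2a + r`, where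
a vertex of degree `a` cannot be deleted within the row (the cell `(k − 1, a, r)` lies outside the dense corner) and
the deletion onto the diagonal of the row `a − 1` is short by `2 (r − 2)(a − r)` for `r ≥ 3`. THE POINT: at the
corner, if some vertex has degree `≤ a − 1` it is deleted onto a cell `(k − 1, a, r')` with `r' ≤ r − 1` (inside
the dense corner of `k − 1`, the induction hypothesis) or across the row (part 196a), and if every degree lies in
`[a, k − a − 1]` the convexity of THAT window alone gives `Σ_v d(v)² + r (k − 1 − r) + a (k − 2a) + r (r − 1) ≤ m k`
(`below_window_gen`), which is the target at `k = 2a + r` as soon as `a (r − 2) ≤ 3r (r − 1)` — true for every `a` when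
`r ≤ 2` and for every `r` when `a ≤ 18` (`corner_window_arith`). Away from the corner a vertex of degree `a` is deleted within the row as in
part 196c (exact). `below_second_order_all`: the theorem; `three_below_second_order_gen`: the row `r = 3` for every
`6 ≤ a ≤ 18` (the rows `a = 4, 5` at `r = 3` are the `T` cells of parts 199d/199g). Axioms: standard.
-/

namespace PercRepro

namespace TriangleCap

namespace C047

open Finset

universe u

variable {V : Type*} [Fintype V] [DecidableEq V]

/-- The convexity term of the window `[a, k − a − 1]`: `a ≤ d ≤ k − a − 1` ⇒ `d² + a (k − a − 1) ≤ (k − 1) d`. -/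
theorem convex_vertex_window (d k a : ℕ) (hd : a ≤ d) (hk : d + a + 1 ≤ k) :
    d * d + a * (k - a - 1) ≤ (k - 1) * d := by
  obtain ⟨u, rfl⟩ : ∃ u, d = a + u := ⟨d - a, by omega⟩
  obtain ⟨b, rfl⟩ : ∃ b, k = a + u + a + 1 + b := ⟨k - (a + u + a + 1), by omega⟩
  have e1 : a + u + a + 1 + b - a - 1 = a + u + b := by omega
  have e2 : a + u + a + 1 + b - 1 = a + u + a + b := by omega
  rw [e1, e2]
  nlinarith

omit [DecidableEq V] in
/-- **EVERY DEGREE IN `[a, k − a − 1]` ON THE CELL `(k, a, r)`:** `Σ_v d(v)² + r (k − 1 − r) + a (k − 2a) + r (r − 1) ≤ m k`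
for `m + r = a (k − a)`, `r ≤ a`, `2a + 1 ≤ k`. -/
theorem below_window_gen (D : SimpleGraph V) [DecidableRel D.Adj] (a r : ℕ) (hr : r ≤ a)
    (hk : 2 * a + 1 ≤ Fintype.card V) (hm : D.edgeFinset.card + r = a * (Fintype.card V - a))
    (hcap : ∀ v, deg D v + a + 1 ≤ Fintype.card V) (hdeg : ∀ v, a ≤ deg D v) :
    ∑ v, deg D v * deg D v + r * (Fintype.card V - 1 - r) + a * (Fintype.card V - 2 * a) + r * (r - 1) ≤
      D.edgeFinset.card * Fintype.card V := by
  have hsum : ∑ v, (deg D v * deg D v + a * (Fintype.card V - a - 1)) ≤ ∑ v, (Fintype.card V - 1) * deg D v :=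
    sum_le_sum (fun v _ => convex_vertex_window (deg D v) (Fintype.card V) a (hdeg v) (hcap v))
  rw [sum_add_distrib, sum_const, card_univ, smul_eq_mul, ← mul_sum, sum_deg_eq] at hsum
  obtain ⟨k, hk'⟩ : ∃ k, Fintype.card V = k := ⟨_, rfl⟩
  obtain ⟨S, hS⟩ : ∃ S, ∑ v, deg D v * deg D v = S := ⟨_, rfl⟩
  obtain ⟨m, hmdef⟩ : ∃ m, D.edgeFinset.card = m := ⟨_, rfl⟩
  rw [hk'] at hsum hm hk
  rw [hS, hmdef] at hsum
  rw [hmdef] at hm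
  rw [hS, hk', hmdef]
  obtain ⟨q, rfl⟩ : ∃ q, a = r + q := ⟨a - r, by omega⟩
  obtain ⟨t, rfl⟩ : ∃ t, k = 2 * (r + q) + 1 + t := ⟨k - (2 * (r + q) + 1), by omega⟩
  have e1 : 2 * (r + q) + 1 + t - (r + q) - 1 = r + q + t := by omega
  have e2 : 2 * (r + q) + 1 + t - 1 = 2 * (r + q) + t := by omega
  have e3 : 2 * (r + q) + 1 + t - (r + q) = r + q + 1 + t := by omega
  have e4 : 2 * (r + q) + 1 + t - 1 - r = r + 2 * q + t := by omega
  have e5 : 2 * (r + q) + 1 + t - 2 * (r + q) = 1 + t := by omega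
  rw [e1, e2] at hsum
  rw [e3] at hm
  rw [e4, e5]
  rcases Nat.eq_zero_or_pos r with hr0 | hr1
  · subst hr0
    simp only [zero_add, zero_mul, add_zero, Nat.zero_sub, mul_zero] at hsum hm ⊢
    nlinarith [hsum, hm]
  · obtain ⟨r', rfl⟩ : ∃ r', r = r' + 1 := ⟨r - 1, by omega⟩
    have e6 : r' + 1 - 1 = r' := by omega
    rw [e6]
    nlinarith [hsum, hm]

/-- At the corner `k = 2a + r` the window bound reaches `B2`: `2 (r − 1)(a − r) ≤ a r + r (r − 1)` for
`r + 3 ≤ a` with `r ≤ 2` or `a ≤ 18` (the condition is `a (r − 2) ≤ 3r (r − 1)`). -/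
theorem corner_window_arith (a r : ℕ) (h : r ≤ 2 ∨ a ≤ 18) (har : r + 3 ≤ a) :
    2 * (r - 1) * (a - r) ≤ a * r + r * (r - 1) := by
  rcases h with hr2 | ha18
  · interval_cases r <;> omega
  · have hr : r ≤ 15 := by omega
    interval_cases r <;> omega

omit [DecidableEq V] in
/-- **THE CORNER `k = 2a + r` WITH EVERY DEGREE IN `[a, k − a − 1]`:** `Σ_v d(v)² + r (k − 1 − r) + 2 (k − 2a − 1)(a − r) ≤ m k`
for `r + 3 ≤ a`, `r ≤ 2` or `a ≤ 18`. -/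
theorem below_corner_window (D : SimpleGraph V) [DecidableRel D.Adj] (a r : ℕ) (h18 : r ≤ 2 ∨ a ≤ 18)
    (har : r + 3 ≤ a) (hk2 : 2 * a + 2 ≤ Fintype.card V)
    (hk : Fintype.card V = 2 * a + r) (hm : D.edgeFinset.card + r = a * (Fintype.card V - a))
    (hcap : ∀ v, deg D v + a + 1 ≤ Fintype.card V) (hdeg : ∀ v, a ≤ deg D v) :
    ∑ v, deg D v * deg D v + r * (Fintype.card V - 1 - r) + 2 * (Fintype.card V - 2 * a - 1) * (a - r) ≤
      D.edgeFinset.card * Fintype.card V := by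
  have h := below_window_gen D a r (by omega) (by omega) hm hcap hdeg
  have harith := corner_window_arith a r h18 har
  have e1 : Fintype.card V - 2 * a = r := by omega
  have e2 : Fintype.card V - 2 * a - 1 = r - 1 := by omega
  rw [e1] at h
  rw [e2]
  omega

/-- **THE STABILITY TABLE BELOW THE DIAGONAL, EVERY `r ≤ a − 3`, EVERY VERTEX TYPE, BY INDUCTION ON `k`:** `K₄⁻`-free,
`4 ≤ a`, `r ≤ 2` or `a ≤ 18`, `r + 3 ≤ a`, `2a + r ≤ k`, `m + r = a (k − a)` ⇒ `a`-bipartite or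
`Σ_v d(v)² + r (k − 1 − r) + 2 (k − 2a − 1)(a − r) ≤ m k`. -/
theorem below_second_order_all_aux (n : ℕ) :
    ∀ (W : Type u) [Fintype W] [DecidableEq W] (D : SimpleGraph W) [DecidableRel D.Adj], Fintype.card W = n →
      K4mFree D → ∀ a r : ℕ, 4 ≤ a → (r ≤ 2 ∨ a ≤ 18) → r + 3 ≤ a → 2 * a + r ≤ Fintype.card W →
      D.edgeFinset.card + r = a * (Fintype.card W - a) →
      (∃ A : Finset W, A.card = a ∧ BipSub D A) ∨
        ∑ v, deg D v * deg D v + r * (Fintype.card W - 1 - r) + 2 * (Fintype.card W - 2 * a - 1) * (a - r) ≤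
          D.edgeFinset.card * Fintype.card W := by
  refine Nat.strong_induction_on n ?_
  intro n ih W _ _ D _ hn hK a r ha4 hr18 har hk hm
  -- `k ≤ 2a + 1`: the closed form
  rcases Nat.lt_or_ge (Fintype.card W) (2 * a + 2) with hk1 | hk2
  · right
    have h := closed_form_stability D hK a r (by omega) hk
      (below_cap_arith a (Fintype.card W) D.edgeFinset.card r (by omega) hm)
    have e : Fintype.card W - 2 * a - 1 = 0 := by omega
    rw [e, mul_zero, zero_mul, add_zero]
    exact h
  -- (A) a vertex at the cap `k − a` makes `D` `a`-bipartite
  by_cases hx : ∃ x, deg D x + a = Fintype.card W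
  · obtain ⟨x, hx⟩ := hx
    exact Or.inl (below_cap_gen D hK a r ha4 har hk hm (by omega) (fun _ => by omega) x hx)
  push Not at hx
  have hcap : ∀ v, deg D v + a ≤ Fintype.card W := fun v =>
    deg_add_le_card_of_dense D hK a (by omega) (by omega)
      (cap_arith a (Fintype.card W) D.edgeFinset.card r (by omega) hk
        (below_cap_arith a (Fintype.card W) D.edgeFinset.card r (by omega) hm)) v
  have hcap' : ∀ v, deg D v + a + 1 ≤ Fintype.card W := fun v => by
    have h1 := hcap v
    have h2 := hx v
    omega
  -- (B) every degree `≥ a + 1`: the convexity of the row `a + 1`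
  by_cases hdeg : ∀ v, a + 1 ≤ deg D v
  · right
    have h := below_convex_gen D a r (by omega) (by omega) hm hcap' hdeg
    have h2 : 2 * (Fintype.card W - 2 * a - 1) * (a - r) ≤
        Fintype.card W * (Fintype.card W - 2 * a - 1) := by
      rw [mul_right_comm]
      exact Nat.mul_le_mul_right _ (by omega)
    omega
  push Not at hdeg
  -- (B') every degree `≥ a`, some vertex of degree exactly `a`
  by_cases hdega : ∀ v, a ≤ deg D v
  · obtain ⟨z, hz⟩ := hdeg
    have hza : deg D z = a := by have := hdega z; omega
    rcases Nat.lt_or_ge (Fintype.card W) (2 * a + r + 1) with hcorner | hnot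
    · -- THE CORNER `k = 2a + r`: the window `[a, k − a − 1]`
      right
      exact below_corner_window D a r hr18 har hk2 (by omega) hm hcap' hdega
    · -- `k ≥ 2a + r + 1`: the within-row deletion onto `(k − 1, a, r)`
      have hedges' := card_edges_del D z
      have hm' : (del D z).edgeFinset.card + r = a * (Fintype.card {v : W // v ≠ z} - a) := by
        have e : Fintype.card {v : W // v ≠ z} = Fintype.card W - 1 := by have := card_del z; omega
        rw [e]
        exact below_cell_edges a r r (deg D z) (Fintype.card W) D.edgeFinset.card (del D z).edgeFinset.card
          hk2 (by omega) hedges' hm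
      have hIH := ih (Fintype.card {v : W // v ≠ z}) (by have := card_del z; omega) {v : W // v ≠ z} (del D z) rfl
        (k4mFree_del D hK z) a r ha4 hr18 har (by have := card_del z; omega) hm'
      exact below_within_case D hK a r har hk2 hm hcap' z (by omega) r (by omega) hIH
  push Not at hdega
  obtain ⟨z, hz⟩ := hdega
  -- (C) `r + d ≤ a − 1`: the cross-row deletion
  rcases Nat.lt_or_ge (r + deg D z) a with hz1 | hz2
  · exact Or.inr (below_cross_gen D hK a r (by omega) hk2 hm hcap' z (by omega))
  -- (D) `r + d ≥ a`, `d ≤ a − 1`: the deletion onto the cell `(k − 1, a, r')`, `r' = r + d − a ≤ r − 1`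
  obtain ⟨r', hr'⟩ : ∃ r', r + deg D z = a + r' := ⟨r + deg D z - a, by omega⟩
  have hcard' := card_del z
  have hedges' := card_edges_del D z
  have hm' : (del D z).edgeFinset.card + r' = a * (Fintype.card {v : W // v ≠ z} - a) := by
    have e : Fintype.card {v : W // v ≠ z} = Fintype.card W - 1 := by omega
    rw [e]
    exact below_cell_edges a r r' (deg D z) (Fintype.card W) D.edgeFinset.card (del D z).edgeFinset.card
      hk2 hr' hedges' hm
  have hIH := ih (Fintype.card {v : W // v ≠ z}) (by omega) {v : W // v ≠ z} (del D z) rfl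
    (k4mFree_del D hK z) a r' ha4 (by omega) (by omega) (by omega) hm'
  exact below_within_case D hK a r har hk2 hm hcap' z (by omega) r' hr' hIH

/-- **THE STABILITY TABLE BELOW THE DIAGONAL FOR EVERY `r ≤ a − 3` ON EVERY ROW `4 ≤ a ≤ 18`:** `K₄⁻`-free,
`2a + r ≤ k`, `m + r = a (k − a)` ⇒ `D` is a spanning subgraph of some `K(A, Aᶜ)` with `|A| = a`, or
`Σ_v d(v)² + r (k − 1 − r) + 2 (k − 2a − 1)(a − r) ≤ m k`. -/
theorem below_second_order_all (D : SimpleGraph V) [DecidableRel D.Adj] (hK : K4mFree D) (a r : ℕ)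
    (ha4 : 4 ≤ a) (ha18 : a ≤ 18) (har : r + 3 ≤ a) (hk : 2 * a + r ≤ Fintype.card V)
    (hm : D.edgeFinset.card + r = a * (Fintype.card V - a)) :
    (∃ A : Finset V, A.card = a ∧ BipSub D A) ∨
      ∑ v, deg D v * deg D v + r * (Fintype.card V - 1 - r) + 2 * (Fintype.card V - 2 * a - 1) * (a - r) ≤
        D.edgeFinset.card * Fintype.card V :=
  below_second_order_all_aux (Fintype.card V) V D rfl hK a r ha4 (Or.inr ha18) har hk hm

/-- **THREE BELOW THE DIAGONAL AT SECOND ORDER, EVERY ROW `6 ≤ a ≤ 18`:** `K₄⁻`-free, `2a + 3 ≤ k`,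
`m + 3 = a (k − a)` ⇒ `a`-bipartite or `Σ_v d(v)² + 3 (k − 4) + 2 (k − 2a − 1)(a − 3) ≤ m k`. -/
theorem three_below_second_order_gen (D : SimpleGraph V) [DecidableRel D.Adj] (hK : K4mFree D) (a : ℕ)
    (ha : 6 ≤ a) (ha18 : a ≤ 18) (hk : 2 * a + 3 ≤ Fintype.card V)
    (hm : D.edgeFinset.card + 3 = a * (Fintype.card V - a)) :
    (∃ A : Finset V, A.card = a ∧ BipSub D A) ∨
      ∑ v, deg D v * deg D v + 3 * (Fintype.card V - 4) + 2 * (Fintype.card V - 2 * a - 1) * (a - 3) ≤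
        D.edgeFinset.card * Fintype.card V := by
  rcases below_second_order_all D hK a 3 (by omega) ha18 (by omega) hk hm with h | h
  · exact Or.inl h
  · right
    have e : Fintype.card V - 1 - 3 = Fintype.card V - 4 := by omega
    rw [e] at h
    exact h

end C047

end TriangleCap

end PercRepro
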